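import Mathlib.NumberTheory.ModularForms.JacobiTheta.TwoVariable
import Mathlib.NumberTheory.ModularForms.JacobiTheta.OneVariable
import Mathlib.Analysis.Complex.LocallyUniformLimit
import Mathlib.Analysis.Complex.Convex
import Mathlib.NumberTheory.ModularForms.LevelOne.DimensionFormula
import HarnessLib

/-!
# Jacobi's derivative formula `θ₁'(0) = θ₂(0) θ₃(0) θ₄(0)`

Jacobi's identity between the four *thetanullwerte* (Jacobi 1829; Lawden, *Elliptic Functions
and Applications*, §1.5, eq. (1.5.11): "`θ₁'(0) = θ₂(0) θ₃(0) θ₄(0)`", with (1.5.7)–(1.5.10)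
`θ₁'(0, q) = ∑ (-1)ⁿ (2n+1) q^{(n+½)²}`, `θ₂(0, q) = ∑ q^{(n+½)²}`, `θ₃(0, q) = ∑ q^{n²}`,
`θ₄(0, q) = ∑ (-1)ⁿ q^{n²}`, `q = e^{πiτ}`; Whittaker–Watson §21.41), PROVED, for the functions
of `τ` built from Mathlib's two-variable theta function `jacobiTheta₂ z τ = ∑ e^{2πinz + πin²τ}`
and its `z`-derivative `jacobiTheta₂'`:

* `theta3 τ = θ(0, τ)`, `theta4 τ = θ(½, τ)`, `theta2 τ = e^{πiτ/4} θ(τ/2, τ)` and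
  `theta1' τ = e^{πiτ/4} (πi)⁻¹ ∂_z θ((1+τ)/2, τ) = ∑ (-1)ⁿ (2n+1) e^{πi(n+½)²τ}` (Lawden's
  `θ₁'(0, q)`; the normalising identity `∑ (-1)ⁿ e^{πi(n+½)²τ} = θ₁(0) = 0` is
  `jacobiTheta₂_halfPeriod`);
* **`jacobi_derivative_formula : theta1' τ = theta2 τ * theta3 τ * theta4 τ`** for every
  `τ : ℂ` (both sides are `0` off the upper half-plane, by Mathlib's junk-value convention).

## Proof

Not Lawden's (who iterates Landen's transformation) nor Whittaker–Watson's (heat equation), but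
the modular one, which Mathlib's level-one theory now supports: from the functional equations of
`jacobiTheta₂`, `jacobiTheta₂'` (Poisson summation, Mathlib) we get the laws
`θ₃(τ+1) = θ₄`, `θ₄(τ+1) = θ₃`, `θ₂(τ+1) = e^{πi/4} θ₂`, `D(τ+1) = e^{πi/4} D` and
`θ₃(-1/τ) = (-iτ)^{1/2} θ₃`, `θ₄(-1/τ) = (-iτ)^{1/2} θ₂`, `θ₂(-1/τ) = (-iτ)^{1/2} θ₄`,
`D(-1/τ) = (-iτ)(-iτ)^{1/2} D` (`D = theta1'`, `P = θ₂θ₃θ₄`), so that `D P⁷` and `P⁸` are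
invariant of weight `12` under `S` and `T`; they are holomorphic (locally uniform convergence) and
vanish at `i∞` (`θ₃, θ₄ → 1`, `e^{-πiτ/4} θ₂ → 2`, `e^{-πiτ/4} D → 2`), hence cusp forms of weight
`12` for `SL₂(ℤ)` (`cuspFormOf`, via Mathlib's `slash_action_generators_SL2Z`), hence both are
multiples of `Δ` (`CuspForm.exists_smul_discriminant_of_weight_eq_twelve`); comparing the two
relations where `P ≠ 0` gives `D = c P` near `i∞`, the limits give `c = 1`, and the identity
theorem on the (convex) upper half-plane gives `D = P`.

This file is Mathlib-only. Its sequel specialises `τ = 8z` to obtain the `q`-series identity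
`∑ (-1)ⁿ (2n+1) q^{(2n+1)²} = (∑ q^{(2n+1)²}) (∑ q^{4n²}) (∑ (-1)ⁿ q^{4n²})` used in the Tunnell
cluster (`Literature/NumberTheory/EllipticCurves/Tunnell*`: the ordinary half of the
Shimura–Niwa input for `g θ₈`, Tunnell 1983, Thm 2).

## References

* D. F. Lawden, *Elliptic Functions and Applications*, Applied Math. Sciences 80, Springer (1989),
  §1.5, eqs. (1.5.7)–(1.5.11) (held: `lit read book:lawden1989-elliptic-functions-applications`,
  PDF p. 51). [Lawden1989]
* E. T. Whittaker, G. N. Watson, *A Course of Modern Analysis*, 4th ed. (1927), §21.41.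
  [WhittakerWatson1927]
* C. G. J. Jacobi, *Fundamenta nova theoriae functionum ellipticarum* (1829), §65.
-/

noncomputable section

open Complex Real Filter Topology Asymptotics

open scoped Real

namespace Literature.NumberTheory.EllipticCurves.JacobiThetaNull

/-- `θ₃(τ) = ∑ₙ e^{πin²τ}` (Jacobi's third thetanull; Mathlib's `jacobiTheta`). [folklore] -/
def theta3 (τ : ℂ) : ℂ := jacobiTheta₂ 0 τ

/-- `θ₄(τ) = ∑ₙ (-1)ⁿ e^{πin²τ}`. [folklore] -/
def theta4 (τ : ℂ) : ℂ := jacobiTheta₂ (1 / 2) τ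

/-- `θ₂(τ) = ∑ₙ e^{πi(n+½)²τ} = e^{πiτ/4} ∑ₙ e^{πi(n²+n)τ}`. [folklore] -/
def theta2 (τ : ℂ) : ℂ := cexp (π * I * τ / 4) * jacobiTheta₂ (τ / 2) τ

/-- `D(τ) = θ₁'(0|τ)/π = ∑ₙ (-1)ⁿ (2n+1) e^{πi(n+½)²τ} = e^{πiτ/4} (πi)⁻¹ ∂_z θ((1+τ)/2, τ)`
(`∂_z θ = jacobiTheta₂'`). [folklore] -/
def theta1' (τ : ℂ) : ℂ := cexp (π * I * τ / 4) / (π * I) * jacobiTheta₂' ((1 + τ) / 2) τ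

/-! ### Termwise identities -/

/-- `n² - n` is even. [folklore] -/
theorem exists_sq_sub_eq_two_mul (n : ℤ) : ∃ k : ℤ, n ^ 2 - n = 2 * k := by
  obtain ⟨k, hk⟩ := Int.even_mul_pred_self n
  exact ⟨k, by rw [← two_mul] at hk; linear_combination hk⟩

/-- `θ`-terms: shifting `τ` by `1` is shifting `z` by `½`. [folklore] -/
theorem jacobiTheta₂_term_add_one (n : ℤ) (z τ : ℂ) :
    jacobiTheta₂_term n z (τ + 1) = jacobiTheta₂_term n (z + 1 / 2) τ := by
  rw [jacobiTheta₂_term, jacobiTheta₂_term, Complex.exp_eq_exp_iff_exists_int]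
  obtain ⟨k, hk⟩ := exists_sq_sub_eq_two_mul n
  refine ⟨k, ?_⟩
  have hk' : ((n : ℂ) ^ 2 - n) = 2 * k := by exact_mod_cast hk
  linear_combination (↑π * I) * hk'

/-- The same for the `z`-derivative terms. [folklore] -/
theorem jacobiTheta₂'_term_add_one (n : ℤ) (z τ : ℂ) :
    jacobiTheta₂'_term n z (τ + 1) = jacobiTheta₂'_term n (z + 1 / 2) τ := by
  rw [jacobiTheta₂'_term, jacobiTheta₂'_term, jacobiTheta₂_term_add_one]

/-- `θ(z, τ + 1) = θ(z + ½, τ)`. [folklore] -/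
theorem jacobiTheta₂_add_one (z τ : ℂ) : jacobiTheta₂ z (τ + 1) = jacobiTheta₂ (z + 1 / 2) τ :=
  tsum_congr fun n ↦ jacobiTheta₂_term_add_one n z τ

/-- `θ'(z, τ + 1) = θ'(z + ½, τ)`. [folklore] -/
theorem jacobiTheta₂'_add_one (z τ : ℂ) : jacobiTheta₂' z (τ + 1) = jacobiTheta₂' (z + 1 / 2) τ :=
  tsum_congr fun n ↦ jacobiTheta₂'_term_add_one n z τ

/-- The involution `n ↦ -1 - n` of `ℤ`. [folklore] -/
def negOneSub : ℤ ≃ ℤ where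
  toFun n := -1 - n
  invFun n := -1 - n
  left_inv n := by ring
  right_inv n := by ring

/-- `θ`-terms at the odd half-period `z = (1+τ)/2` are odd under `n ↦ -1-n`. [folklore] -/
theorem jacobiTheta₂_term_halfPeriod_negOneSub (n : ℤ) (τ : ℂ) :
    jacobiTheta₂_term (-1 - n) ((1 + τ) / 2) τ = -jacobiTheta₂_term n ((1 + τ) / 2) τ := by
  have h : jacobiTheta₂_term (-1 - n) ((1 + τ) / 2) τ =
      cexp (π * I) * jacobiTheta₂_term n ((1 + τ) / 2) τ := by
    rw [jacobiTheta₂_term, jacobiTheta₂_term, ← Complex.exp_add,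
      Complex.exp_eq_exp_iff_exists_int]
    refine ⟨-1 - n, ?_⟩
    push_cast
    ring
  rw [h, Complex.exp_pi_mul_I, neg_one_mul]

/-- **`θ₁(0|τ) = 0`**: `θ((1+τ)/2, τ) = 0`. [folklore] -/
theorem jacobiTheta₂_halfPeriod (τ : ℂ) : jacobiTheta₂ ((1 + τ) / 2) τ = 0 := by
  have h : jacobiTheta₂ ((1 + τ) / 2) τ = -jacobiTheta₂ ((1 + τ) / 2) τ := by
    conv_lhs => rw [jacobiTheta₂, ← negOneSub.tsum_eq]
    rw [jacobiTheta₂, ← tsum_neg]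
    exact tsum_congr fun n ↦ jacobiTheta₂_term_halfPeriod_negOneSub n τ
  linear_combination (1 / 2 : ℂ) * h

/-! ### Behaviour under `τ ↦ τ + 1` -/

/-- `θ₃(τ + 1) = θ₄(τ)`. [folklore] -/
theorem theta3_add_one (τ : ℂ) : theta3 (τ + 1) = theta4 τ := by
  rw [theta3, theta4, jacobiTheta₂_add_one, zero_add]

/-- `θ₄(τ + 1) = θ₃(τ)`. [folklore] -/
theorem theta4_add_one (τ : ℂ) : theta4 (τ + 1) = theta3 τ := by
  rw [theta4, theta3, jacobiTheta₂_add_one, show (1 / 2 : ℂ) + 1 / 2 = 0 + 1 by norm_num,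
    jacobiTheta₂_add_left]

/-- `θ₂(τ + 1) = e^{πi/4} θ₂(τ)`. [folklore] -/
theorem theta2_add_one (τ : ℂ) : theta2 (τ + 1) = cexp (π * I / 4) * theta2 τ := by
  rw [theta2, theta2, jacobiTheta₂_add_one, show (τ + 1) / 2 + 1 / 2 = τ / 2 + 1 by ring,
    jacobiTheta₂_add_left, show (π * I * (τ + 1) / 4 : ℂ) = π * I * τ / 4 + π * I / 4 by ring,
    Complex.exp_add]
  ring

/-- `D(τ + 1) = e^{πi/4} D(τ)`. [folklore] -/
theorem theta1'_add_one (τ : ℂ) : theta1' (τ + 1) = cexp (π * I / 4) * theta1' τ := by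
  rw [theta1', theta1', jacobiTheta₂'_add_one,
    show (1 + (τ + 1)) / 2 + 1 / 2 = (1 + τ) / 2 + 1 by ring, jacobiTheta₂'_add_left,
    show (π * I * (τ + 1) / 4 : ℂ) = π * I * τ / 4 + π * I / 4 by ring, Complex.exp_add]
  ring

/-! ### Behaviour under `τ ↦ -1/τ` -/

section S

variable {τ : ℂ}

/-- `τ ≠ 0` on the upper half-plane. [folklore] -/
theorem ne_zero_of_im_pos (hτ : 0 < im τ) : τ ≠ 0 := fun h ↦ by simp [h] at hτ

/-- `-iτ ≠ 0`. [folklore] -/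
theorem neg_I_mul_ne_zero (hτ : 0 < im τ) : -I * τ ≠ 0 :=
  mul_ne_zero (neg_ne_zero.mpr I_ne_zero) (ne_zero_of_im_pos hτ)

/-- `(-iτ)^{1/2} ≠ 0`. [folklore] -/
theorem cpow_half_ne_zero (hτ : 0 < im τ) : (-I * τ) ^ (1 / 2 : ℂ) ≠ 0 := by
  rw [Ne, cpow_eq_zero_iff, not_and_or]
  exact Or.inl (neg_I_mul_ne_zero hτ)

/-- `-1/(-1/τ) = τ`. [folklore] -/
theorem neg_one_div_neg_one_div (hτ : 0 < im τ) : -1 / (-1 / τ) = τ := by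
  have := ne_zero_of_im_pos hτ
  field_simp

/-- `Im(-1/τ) > 0`. [folklore] -/
theorem im_neg_one_div_pos (hτ : 0 < im τ) : 0 < im (-1 / τ) := by
  rw [neg_div, neg_im, one_div, inv_im, neg_div, neg_neg]
  exact div_pos hτ (normSq_pos.mpr (ne_zero_of_im_pos hτ))

/-- `-i(-1/τ) = (-iτ)⁻¹`. [folklore] -/
theorem neg_I_mul_neg_one_div (hτ : 0 < im τ) : -I * (-1 / τ) = (-I * τ)⁻¹ := by
  have := ne_zero_of_im_pos hτ
  field_simp
  exact I_sq

/-- `arg(-iτ) ≠ π` (`-iτ` has positive real part). [folklore] -/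
theorem arg_neg_I_mul_ne_pi (hτ : 0 < im τ) : (-I * τ).arg ≠ π := by
  rw [Ne, Complex.arg_eq_pi_iff, not_and_or]
  left
  have : (-I * τ).re = τ.im := by simp
  rw [this]
  exact not_lt.mpr hτ.le

/-- `1/(-i(-1/τ))^{1/2} = (-iτ)^{1/2}`. [folklore] -/
theorem one_div_cpow_half_neg_one_div (hτ : 0 < im τ) :
    1 / (-I * (-1 / τ)) ^ (1 / 2 : ℂ) = (-I * τ) ^ (1 / 2 : ℂ) := by
  rw [neg_I_mul_neg_one_div hτ, Complex.inv_cpow _ _ (arg_neg_I_mul_ne_pi hτ), one_div, inv_inv]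

/-- **`θ₃(-1/τ) = (-iτ)^{1/2} θ₃(τ)`.** [folklore] -/
theorem theta3_neg_one_div (hτ : 0 < im τ) :
    theta3 (-1 / τ) = (-I * τ) ^ (1 / 2 : ℂ) * theta3 τ := by
  rw [theta3, theta3, jacobiTheta₂_functional_equation 0 (-1 / τ), neg_one_div_neg_one_div hτ,
    one_div_cpow_half_neg_one_div hτ]
  simp

/-- **`θ₄(-1/τ) = (-iτ)^{1/2} θ₂(τ)`.** [folklore] -/
theorem theta4_neg_one_div (hτ : 0 < im τ) :
    theta4 (-1 / τ) = (-I * τ) ^ (1 / 2 : ℂ) * theta2 τ := by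
  have h0 := ne_zero_of_im_pos hτ
  rw [theta4, theta2, jacobiTheta₂_functional_equation (1 / 2) (-1 / τ),
    neg_one_div_neg_one_div hτ, one_div_cpow_half_neg_one_div hτ,
    show (1 / 2 : ℂ) / (-1 / τ) = -(τ / 2) by field_simp, jacobiTheta₂_neg_left,
    show (-π * I * (1 / 2) ^ 2 / (-1 / τ) : ℂ) = π * I * τ / 4 by field_simp; ring]
  ring

/-- **`θ₂(-1/τ) = (-iτ)^{1/2} θ₄(τ)`.** [folklore] -/
theorem theta2_neg_one_div (hτ : 0 < im τ) :
    theta2 (-1 / τ) = (-I * τ) ^ (1 / 2 : ℂ) * theta4 τ := by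
  have h0 := ne_zero_of_im_pos hτ
  have h0' : (-1 / τ : ℂ) ≠ 0 := ne_zero_of_im_pos (im_neg_one_div_pos hτ)
  rw [theta2, theta4, jacobiTheta₂_functional_equation (-1 / τ / 2) (-1 / τ),
    neg_one_div_neg_one_div hτ, one_div_cpow_half_neg_one_div hτ,
    show (-1 / τ / 2 : ℂ) / (-1 / τ) = 1 / 2 by field_simp,
    show (-π * I * (-1 / τ / 2) ^ 2 / (-1 / τ) : ℂ) = -(π * I * (-1 / τ) / 4) by field_simp; ring,
    Complex.exp_neg]
  have he : cexp (π * I * (-1 / τ) / 4) ≠ 0 := Complex.exp_ne_zero _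
  field_simp

/-- `θ'` at `(1 - τ)/2`: `θ'((1-τ)/2, τ) = -θ'((1+τ)/2, τ)`. [folklore] -/
theorem jacobiTheta₂'_one_sub_div_two (τ : ℂ) :
    jacobiTheta₂' ((1 - τ) / 2) τ = -jacobiTheta₂' ((1 + τ) / 2) τ := by
  rw [show (1 - τ) / 2 = -((1 + τ) / 2) + 1 by ring, jacobiTheta₂'_add_left, jacobiTheta₂'_neg_left]

/-- `θ` at `(1 - τ)/2` vanishes. [folklore] -/
theorem jacobiTheta₂_one_sub_div_two (τ : ℂ) : jacobiTheta₂ ((1 - τ) / 2) τ = 0 := by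
  rw [show (1 - τ) / 2 = -((1 + τ) / 2) + 1 by ring, jacobiTheta₂_add_left, jacobiTheta₂_neg_left,
    jacobiTheta₂_halfPeriod]

/-- `e^{-πi/2} = -i`. [folklore] -/
theorem exp_neg_pi_div_two_mul_I : cexp (-(π * I / 2)) = -I := by
  rw [Complex.exp_neg, show (π * I / 2 : ℂ) = π / 2 * I by ring, Complex.exp_pi_div_two_mul_I,
    inv_I]

/-- **`D(-1/τ) = (-iτ)(-iτ)^{1/2} D(τ)`** (Jacobi: `θ₁'(0|-1/τ) = (-iτ)^{3/2} θ₁'(0|τ)`). [folklore] -/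
theorem theta1'_neg_one_div (hτ : 0 < im τ) :
    theta1' (-1 / τ) = (-I * τ) * (-I * τ) ^ (1 / 2 : ℂ) * theta1' τ := by
  have h0 := ne_zero_of_im_pos hτ
  have h0' : (-1 / τ : ℂ) ≠ 0 := ne_zero_of_im_pos (im_neg_one_div_pos hτ)
  have hw : (1 + -1 / τ) / 2 / (-1 / τ) = (1 - τ) / 2 := by field_simp; ring
  rw [theta1', theta1', jacobiTheta₂'_functional_equation ((1 + -1 / τ) / 2) (-1 / τ),
    neg_one_div_neg_one_div hτ, one_div_cpow_half_neg_one_div hτ, hw,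
    jacobiTheta₂_one_sub_div_two, jacobiTheta₂'_one_sub_div_two, mul_zero, sub_zero]
  -- the exponential factors
  have key : (π * I * (-1 / τ) / 4 : ℂ) + -π * I * ((1 + -1 / τ) / 2) ^ 2 / (-1 / τ) =
      π * I * τ / 4 + -(π * I / 2) := by
    field_simp
    ring
  have hexp : cexp (π * I * (-1 / τ) / 4) * cexp (-π * I * ((1 + -1 / τ) / 2) ^ 2 / (-1 / τ)) =
      cexp (π * I * τ / 4) * -I := by
    rw [← Complex.exp_add, key, Complex.exp_add, exp_neg_pi_div_two_mul_I]
  have hπ : (π : ℂ) * I ≠ 0 := mul_ne_zero (ofReal_ne_zero.mpr pi_ne_zero) I_ne_zero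
  calc cexp (π * I * (-1 / τ) / 4) / (π * I) *
        ((-I * τ) ^ (1 / 2 : ℂ) * cexp (-π * I * ((1 + -1 / τ) / 2) ^ 2 / (-1 / τ)) / (-1 / τ) *
          -jacobiTheta₂' ((1 + τ) / 2) τ)
      = (cexp (π * I * (-1 / τ) / 4) * cexp (-π * I * ((1 + -1 / τ) / 2) ^ 2 / (-1 / τ))) *
          τ * (-I * τ) ^ (1 / 2 : ℂ) / (π * I) * jacobiTheta₂' ((1 + τ) / 2) τ := by
        field_simp
    _ = (-I * τ) * (-I * τ) ^ (1 / 2 : ℂ) * (cexp (π * I * τ / 4) / (π * I) *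
          jacobiTheta₂' ((1 + τ) / 2) τ) := by
        rw [hexp]
        field_simp

end S

/-! ### Holomorphy on the upper half-plane -/

section Holo

variable {τ : ℂ}

/-- `θ₃` is holomorphic on `ℍ`. [folklore] -/
theorem differentiableAt_theta3 (hτ : 0 < im τ) : DifferentiableAt ℂ theta3 τ :=
  differentiableAt_jacobiTheta₂_snd 0 hτ

/-- `θ₄` is holomorphic on `ℍ`. [folklore] -/
theorem differentiableAt_theta4 (hτ : 0 < im τ) : DifferentiableAt ℂ theta4 τ :=
  differentiableAt_jacobiTheta₂_snd (1 / 2) hτ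

/-- `τ ↦ θ(τ/2, τ)` is holomorphic on `ℍ`. [folklore] -/
theorem differentiableAt_jacobiTheta₂_half (hτ : 0 < im τ) :
    DifferentiableAt ℂ (fun τ : ℂ ↦ jacobiTheta₂ (τ / 2) τ) τ := by
  have hg := (hasFDerivAt_jacobiTheta₂ (τ / 2) hτ).differentiableAt
  have hf : DifferentiableAt ℂ (fun τ : ℂ ↦ (τ / 2, τ)) τ := by fun_prop
  have := DifferentiableAt.comp (𝕜 := ℂ) τ (g := fun p : ℂ × ℂ ↦ jacobiTheta₂ p.1 p.2)
    (f := fun τ : ℂ ↦ (τ / 2, τ)) hg hf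
  simpa only [Function.comp_def] using this

/-- `θ₂` is holomorphic on `ℍ`. [folklore] -/
theorem differentiableAt_theta2 (hτ : 0 < im τ) : DifferentiableAt ℂ theta2 τ := by
  unfold theta2
  exact (by fun_prop : DifferentiableAt ℂ (fun τ : ℂ ↦ cexp (π * I * τ / 4)) τ).mul
    (differentiableAt_jacobiTheta₂_half hτ)

/-- `Im((1+v)/2) = Im(v)/2`. [folklore] -/
theorem im_one_add_div_two (v : ℂ) : im ((1 + v) / 2) = im v / 2 := by
  simp [Complex.add_im]

/-- `τ ↦ θ'((1+τ)/2, τ)` is holomorphic on `ℍ` (locally uniform convergence on horizontal strips).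
[folklore] -/
theorem differentiableAt_jacobiTheta₂'_halfPeriod (hτ : 0 < im τ) :
    DifferentiableAt ℂ (fun v : ℂ ↦ ∑' n : ℤ, jacobiTheta₂'_term n ((1 + v) / 2) v) τ := by
  obtain ⟨T, hT0, hTτ⟩ := exists_between hτ
  set M : ℝ := im τ + 1 with hM
  let V : Set ℂ := {v | T < im v} ∩ {v | im v < M}
  have hVo : IsOpen V :=
    (isOpen_lt continuous_const continuous_im).inter (isOpen_lt continuous_im continuous_const)
  have hτV : τ ∈ V := ⟨hTτ, by show im τ < im τ + 1; linarith⟩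
  have hu := (summable_pow_mul_jacobiTheta₂_term_bound (M / 2) hT0 1).mul_left (2 * π)
  have hdiff : DifferentiableOn ℂ (fun v ↦ ∑' n : ℤ, jacobiTheta₂'_term n ((1 + v) / 2) v) V := by
    refine differentiableOn_tsum_of_summable_norm hu (fun n ↦ ?_) hVo (fun n v hv ↦ ?_)
    · simp only [jacobiTheta₂'_term, jacobiTheta₂_term]
      fun_prop
    · have hv1 : T < im v := hv.1
      have hv2 : im v < M := hv.2
      have hz : |im ((1 + v) / 2)| ≤ M / 2 := by
        rw [im_one_add_div_two, abs_of_nonneg (by linarith [hT0.le, hv1.le])]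
        linarith [hv2.le]
      refine (norm_jacobiTheta₂'_term_le hT0 hz hv1.le n).trans (le_of_eq ?_)
      ring
  exact hdiff.differentiableAt (hVo.mem_nhds hτV)

/-- `D` is holomorphic on `ℍ`. [folklore] -/
theorem differentiableAt_theta1' (hτ : 0 < im τ) : DifferentiableAt ℂ theta1' τ := by
  unfold theta1'
  exact (by fun_prop : DifferentiableAt ℂ (fun τ : ℂ ↦ cexp (π * I * τ / 4) / (π * I)) τ).mul
    (differentiableAt_jacobiTheta₂'_halfPeriod hτ)

end Holo

/-! ### Behaviour at `i∞`: `θ₃, θ₄ → 1`, `e^{-πiτ/4} θ₂ → 2`, `e^{-πiτ/4} D → 2` -/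

section Asymptotics

/-- A tail bound: if `∑ t = S` and `‖t n‖ ≤ b n` off a finite set `s`, with `∑ b = B`, `b ≥ 0`,
then `‖S - ∑_{n ∈ s} t n‖ ≤ B`. [folklore] -/
theorem norm_sub_sum_le {t : ℤ → ℂ} {S : ℂ} (ht : HasSum t S) (s : Finset ℤ) {b : ℤ → ℝ}
    {B : ℝ} (hb : HasSum b B) (hb0 : ∀ n, 0 ≤ b n) (h : ∀ n ∉ s, ‖t n‖ ≤ b n) :
    ‖S - ∑ n ∈ s, t n‖ ≤ B := by
  classical
  have h1 : HasSum (fun n ↦ if n ∈ s then t n else 0) (∑ n ∈ s, t n) := by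
    have h1' : HasSum (fun n ↦ if n ∈ s then t n else 0) (∑ n ∈ s, if n ∈ s then t n else 0) :=
      hasSum_sum_of_ne_finset_zero (fun n hn ↦ if_neg hn)
    rwa [Finset.sum_congr rfl (fun n hn ↦ if_pos hn)] at h1'
  refine (ht.sub h1).norm_le_of_bounded hb (fun n ↦ ?_)
  by_cases hn : n ∈ s
  · simp [hn, hb0 n]
  · simpa [hn] using h n hn

/-- `e^{-πwy} ≤ e^{-2πy} e^{2π} e^{-πw}` for `w ≥ 2`, `y ≥ 1`. [folklore] -/
theorem exp_weight_le {w y : ℝ} (hw : 2 ≤ w) (hy : 1 ≤ y) :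
    rexp (-π * w * y) ≤ rexp (-2 * π * y) * (rexp (2 * π) * rexp (-π * w)) := by
  rw [← Real.exp_add, ← Real.exp_add, Real.exp_le_exp]
  nlinarith [pi_pos, mul_nonneg (sub_nonneg.2 hw) (sub_nonneg.2 hy)]

/-- Off `{0, -1}`, `n² + n ≥ 2`. [folklore] -/
theorem two_le_sq_add_self {n : ℤ} (hn : n ∉ ({0, -1} : Finset ℤ)) : (2 : ℝ) ≤ (n : ℝ) ^ 2 + n := by
  have hn' : n ≠ 0 ∧ n ≠ -1 := by simpa using hn
  have : (2 : ℤ) ≤ n ^ 2 + n := by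
    rcases le_or_gt 1 n with h | h
    · nlinarith
    · have : n ≤ -2 := by omega
      nlinarith
  exact_mod_cast this

/-- The summable majorant `|n|^k e^{-π(n² - |n|)}`. [folklore] -/
def majorant (k : ℕ) (n : ℤ) : ℝ :=
  ((|n| : ℤ) : ℝ) ^ k * rexp (-π * (1 * (n : ℝ) ^ 2 - 2 * (1 / 2) * ((|n| : ℤ) : ℝ)))

/-- The majorant is summable. [folklore] -/
theorem summable_majorant (k : ℕ) : Summable (majorant k) :=
  summable_pow_mul_jacobiTheta₂_term_bound (1 / 2) one_pos k

/-- The majorant is nonnegative. [folklore] -/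
theorem majorant_nonneg (k : ℕ) (n : ℤ) : 0 ≤ majorant k n := by
  unfold majorant; positivity

/-- `e^{-π(n²+n)} ≤ e^{-π(n² - |n|)}` (the exponent in the majorant). [folklore] -/
theorem exp_sq_add_le_majorant (n : ℤ) :
    rexp (-π * ((n : ℝ) ^ 2 + n)) ≤ rexp (-π * (1 * (n : ℝ) ^ 2 - 2 * (1 / 2) * ((|n| : ℤ) : ℝ))) := by
  rw [Real.exp_le_exp, Int.cast_abs]
  nlinarith [pi_pos, neg_abs_le (n : ℝ)]

/-- The norm of the `θ`-term at `z` with `Im z = Im τ / 2`: `e^{-π(n²+n) Im τ}`. [folklore] -/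
theorem norm_jacobiTheta₂_term_half {z τ : ℂ} (hz : im z = im τ / 2) (n : ℤ) :
    ‖jacobiTheta₂_term n z τ‖ = rexp (-π * ((n : ℝ) ^ 2 + n) * im τ) := by
  rw [norm_jacobiTheta₂_term, hz]
  congr 1
  ring

/-- The key termwise estimate off `{0, -1}`, for `Im τ ≥ 1`. [folklore] -/
theorem norm_jacobiTheta₂_term_half_le {z τ : ℂ} (hz : im z = im τ / 2) (hτ : 1 ≤ im τ) {n : ℤ}
    (hn : n ∉ ({0, -1} : Finset ℤ)) :
    ‖jacobiTheta₂_term n z τ‖ ≤ rexp (-2 * π * im τ) * (rexp (2 * π) * majorant 0 n) := by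
  rw [norm_jacobiTheta₂_term_half hz, majorant, pow_zero, one_mul]
  refine (exp_weight_le (two_le_sq_add_self hn) hτ).trans ?_
  exact mul_le_mul_of_nonneg_left (mul_le_mul_of_nonneg_left (exp_sq_add_le_majorant n)
    (Real.exp_pos _).le) (Real.exp_pos _).le

/-- **`‖θ(τ/2, τ) - 2‖ ≤ K e^{-2π Im τ}`** for `Im τ ≥ 1`. [folklore] -/
theorem norm_jacobiTheta₂_half_sub_two_le {τ : ℂ} (hτ : 1 ≤ im τ) :
    ‖jacobiTheta₂ (τ / 2) τ - 2‖ ≤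
      rexp (-2 * π * im τ) * (rexp (2 * π) * ∑' n : ℤ, majorant 0 n) := by
  have hτ0 : 0 < im τ := by linarith
  have ht := hasSum_jacobiTheta₂_term (τ / 2) hτ0
  have hz : im (τ / 2) = im τ / 2 := by simp
  have e0 : jacobiTheta₂_term 0 (τ / 2) τ = 1 := by simp [jacobiTheta₂_term]
  have e1 : jacobiTheta₂_term (-1) (τ / 2) τ = 1 := by
    rw [jacobiTheta₂_term, show (2 * π * I * ((-1 : ℤ) : ℂ) * (τ / 2) + π * I * ((-1 : ℤ) : ℂ) ^ 2 * τ)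
      = 0 by push_cast; ring, Complex.exp_zero]
  have hsum : ∑ n ∈ ({0, -1} : Finset ℤ), jacobiTheta₂_term n (τ / 2) τ = 2 := by
    rw [Finset.sum_pair (by decide), e0, e1]; norm_num
  have hb : HasSum (fun n ↦ rexp (-2 * π * im τ) * (rexp (2 * π) * majorant 0 n))
      (rexp (-2 * π * im τ) * (rexp (2 * π) * ∑' n : ℤ, majorant 0 n)) :=
    ((summable_majorant 0).hasSum.mul_left _).mul_left _
  have := norm_sub_sum_le ht {0, -1} hb
    (fun n ↦ mul_nonneg (Real.exp_pos _).le (mul_nonneg (Real.exp_pos _).le (majorant_nonneg 0 n)))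
    (fun n hn ↦ norm_jacobiTheta₂_term_half_le hz hτ hn)
  rwa [hsum] at this

/-- **`‖θ'((1+τ)/2, τ)/(πi) - 2‖ ≤ K' e^{-2π Im τ}`** for `Im τ ≥ 1`. [folklore] -/
theorem norm_jacobiTheta₂'_halfPeriod_sub_two_le {τ : ℂ} (hτ : 1 ≤ im τ) :
    ‖jacobiTheta₂' ((1 + τ) / 2) τ / (π * I) - 2‖ ≤
      rexp (-2 * π * im τ) * (2 * rexp (2 * π) * ∑' n : ℤ, majorant 1 n) := by
  have hτ0 : 0 < im τ := by linarith
  have hπ : (π : ℂ) * I ≠ 0 := mul_ne_zero (ofReal_ne_zero.mpr pi_ne_zero) I_ne_zero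
  have ht := (hasSum_jacobiTheta₂'_term ((1 + τ) / 2) hτ0).div_const (π * I)
  have hz : im ((1 + τ) / 2) = im τ / 2 := im_one_add_div_two τ
  have e0 : jacobiTheta₂'_term 0 ((1 + τ) / 2) τ / (π * I) = 0 := by simp [jacobiTheta₂'_term]
  have e1 : jacobiTheta₂'_term (-1) ((1 + τ) / 2) τ / (π * I) = 2 := by
    rw [jacobiTheta₂'_term, jacobiTheta₂_term,
      show (2 * π * I * ((-1 : ℤ) : ℂ) * ((1 + τ) / 2) + π * I * ((-1 : ℤ) : ℂ) ^ 2 * τ)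
        = -(π * I) by push_cast; ring, Complex.exp_neg, Complex.exp_pi_mul_I]
    push_cast
    field_simp
  have hsum : ∑ n ∈ ({0, -1} : Finset ℤ), jacobiTheta₂'_term n ((1 + τ) / 2) τ / (π * I) = 2 := by
    rw [Finset.sum_pair (by decide), e0, e1]; norm_num
  have hb : HasSum (fun n ↦ rexp (-2 * π * im τ) * (2 * rexp (2 * π) * majorant 1 n))
      (rexp (-2 * π * im τ) * (2 * rexp (2 * π) * ∑' n : ℤ, majorant 1 n)) :=
    ((summable_majorant 1).hasSum.mul_left _).mul_left _
  have key : ∀ n ∉ ({0, -1} : Finset ℤ), ‖jacobiTheta₂'_term n ((1 + τ) / 2) τ / (π * I)‖ ≤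
      rexp (-2 * π * im τ) * (2 * rexp (2 * π) * majorant 1 n) := by
    intro n hn
    have hnorm : ‖jacobiTheta₂'_term n ((1 + τ) / 2) τ / (π * I)‖ =
        2 * |(n : ℝ)| * ‖jacobiTheta₂_term n ((1 + τ) / 2) τ‖ := by
      rw [jacobiTheta₂'_term, norm_div, norm_mul]
      simp only [norm_mul, Complex.norm_two, norm_I, Complex.norm_of_nonneg pi_pos.le,
        norm_intCast, mul_one]
      field_simp
    rw [hnorm]
    have h1 := norm_jacobiTheta₂_term_half_le hz hτ hn
    have h2 : majorant 1 n = |(n : ℝ)| * majorant 0 n := by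
      simp only [majorant, pow_one, pow_zero, one_mul, Int.cast_abs]
    rw [h2]
    calc 2 * |(n : ℝ)| * ‖jacobiTheta₂_term n ((1 + τ) / 2) τ‖
        ≤ 2 * |(n : ℝ)| * (rexp (-2 * π * im τ) * (rexp (2 * π) * majorant 0 n)) := by gcongr
      _ = rexp (-2 * π * im τ) * (2 * rexp (2 * π) * (|(n : ℝ)| * majorant 0 n)) := by ring
  have := norm_sub_sum_le ht {0, -1} hb
    (fun n ↦ mul_nonneg (Real.exp_pos _).le (mul_nonneg (by positivity) (majorant_nonneg 1 n))) key
  rwa [hsum] at this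

/-- `e^{-c Im τ} → 0` at `i∞` for `c > 0`. [folklore] -/
theorem tendsto_exp_neg_mul_im {c : ℝ} (hc : 0 < c) :
    Tendsto (fun τ : ℂ ↦ rexp (-c * im τ)) (comap im atTop) (𝓝 0) := by
  have h1 : Tendsto (fun y : ℝ ↦ rexp (-c * y)) atTop (𝓝 0) := by
    refine Real.tendsto_exp_atBot.comp ?_
    have : Tendsto (fun y : ℝ ↦ c * y) atTop atTop := tendsto_id.const_mul_atTop hc
    exact (tendsto_neg_atTop_atBot.comp this).congr fun y ↦ by
      simp only [Function.comp_apply, neg_mul]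
  exact h1.comp tendsto_comap

/-- **`θ(τ/2, τ) → 2`** as `Im τ → ∞`. [folklore] -/
theorem tendsto_jacobiTheta₂_half :
    Tendsto (fun τ : ℂ ↦ jacobiTheta₂ (τ / 2) τ) (comap im atTop) (𝓝 2) := by
  rw [tendsto_iff_norm_sub_tendsto_zero]
  have h2π : (0 : ℝ) < 2 * π := by positivity
  have hlim := (tendsto_exp_neg_mul_im h2π).mul_const (rexp (2 * π) * ∑' n : ℤ, majorant 0 n)
  rw [zero_mul] at hlim
  refine squeeze_zero' (Eventually.of_forall fun _ ↦ norm_nonneg _) ?_ hlim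
  filter_upwards [preimage_mem_comap (Ici_mem_atTop (1 : ℝ))] with τ hτ
  have := norm_jacobiTheta₂_half_sub_two_le (τ := τ) hτ
  simpa [neg_mul] using this

/-- **`θ'((1+τ)/2, τ)/(πi) → 2`** as `Im τ → ∞`. [folklore] -/
theorem tendsto_jacobiTheta₂'_halfPeriod :
    Tendsto (fun τ : ℂ ↦ jacobiTheta₂' ((1 + τ) / 2) τ / (π * I)) (comap im atTop) (𝓝 2) := by
  rw [tendsto_iff_norm_sub_tendsto_zero]
  have h2π : (0 : ℝ) < 2 * π := by positivity
  have hlim := (tendsto_exp_neg_mul_im h2π).mul_const (2 * rexp (2 * π) * ∑' n : ℤ, majorant 1 n)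
  rw [zero_mul] at hlim
  refine squeeze_zero' (Eventually.of_forall fun _ ↦ norm_nonneg _) ?_ hlim
  filter_upwards [preimage_mem_comap (Ici_mem_atTop (1 : ℝ))] with τ hτ
  have := norm_jacobiTheta₂'_halfPeriod_sub_two_le (τ := τ) hτ
  simpa [neg_mul] using this

/-- **`θ₃(τ) → 1`** as `Im τ → ∞`. [folklore] -/
theorem tendsto_theta3 : Tendsto theta3 (comap im atTop) (𝓝 1) := by
  have h := isBigO_at_im_infty_jacobiTheta_sub_one
  have h0 : Tendsto (fun τ : ℂ ↦ rexp (-π * τ.im)) (comap im atTop) (𝓝 0) :=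
    tendsto_exp_neg_mul_im pi_pos
  have h2 := h.trans_tendsto h0
  rw [tendsto_sub_nhds_zero_iff] at h2
  refine h2.congr fun τ ↦ ?_
  rw [theta3, jacobiTheta_eq_jacobiTheta₂]

/-- `τ ↦ τ + 1` preserves `i∞`. [folklore] -/
theorem tendsto_add_one_comap_im :
    Tendsto (fun τ : ℂ ↦ τ + 1) (comap im atTop) (comap im atTop) := by
  rw [tendsto_comap_iff]
  have : (im ∘ fun τ : ℂ ↦ τ + 1) = im := by funext τ; simp
  rw [this]
  exact tendsto_comap

/-- **`θ₄(τ) → 1`** as `Im τ → ∞` (`θ₄(τ) = θ₃(τ + 1)`). [folklore] -/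
theorem tendsto_theta4 : Tendsto theta4 (comap im atTop) (𝓝 1) := by
  have := tendsto_theta3.comp tendsto_add_one_comap_im
  refine this.congr fun τ ↦ ?_
  simp only [Function.comp_apply, theta3_add_one]

/-- **`e^{-πiτ/4} θ₂(τ) → 2`.** [folklore] -/
theorem tendsto_theta2 :
    Tendsto (fun τ : ℂ ↦ cexp (-(π * I * τ / 4)) * theta2 τ) (comap im atTop) (𝓝 2) := by
  refine tendsto_jacobiTheta₂_half.congr fun τ ↦ ?_
  rw [theta2, ← mul_assoc, Complex.exp_neg, inv_mul_cancel₀ (Complex.exp_ne_zero _), one_mul]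

/-- **`e^{-πiτ/4} D(τ) → 2`.** [folklore] -/
theorem tendsto_theta1' :
    Tendsto (fun τ : ℂ ↦ cexp (-(π * I * τ / 4)) * theta1' τ) (comap im atTop) (𝓝 2) := by
  refine tendsto_jacobiTheta₂'_halfPeriod.congr fun τ ↦ ?_
  rw [theta1', Complex.exp_neg]
  field_simp

end Asymptotics

/-! ### The product `P = θ₂ θ₃ θ₄` -/

/-- `P(τ) = θ₂(τ) θ₃(τ) θ₄(τ)`. [folklore] -/
def thetaP (τ : ℂ) : ℂ := theta2 τ * theta3 τ * theta4 τ

/-- `P(τ + 1) = e^{πi/4} P(τ)`. [folklore] -/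
theorem thetaP_add_one (τ : ℂ) : thetaP (τ + 1) = cexp (π * I / 4) * thetaP τ := by
  rw [thetaP, thetaP, theta2_add_one, theta3_add_one, theta4_add_one]
  ring

/-- `P(-1/τ) = ((-iτ)^{1/2})³ P(τ)`. [folklore] -/
theorem thetaP_neg_one_div {τ : ℂ} (hτ : 0 < im τ) :
    thetaP (-1 / τ) = ((-I * τ) ^ (1 / 2 : ℂ)) ^ 3 * thetaP τ := by
  rw [thetaP, thetaP, theta2_neg_one_div hτ, theta3_neg_one_div hτ, theta4_neg_one_div hτ]
  ring

/-- `P` is holomorphic on `ℍ`. [folklore] -/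
theorem differentiableAt_thetaP {τ : ℂ} (hτ : 0 < im τ) : DifferentiableAt ℂ thetaP τ := by
  unfold thetaP
  exact ((differentiableAt_theta2 hτ).mul (differentiableAt_theta3 hτ)).mul
    (differentiableAt_theta4 hτ)

/-- **`e^{-πiτ/4} P(τ) → 2`.** [folklore] -/
theorem tendsto_thetaP :
    Tendsto (fun τ : ℂ ↦ cexp (-(π * I * τ / 4)) * thetaP τ) (comap im atTop) (𝓝 2) := by
  have := (tendsto_theta2.mul tendsto_theta3).mul tendsto_theta4
  rw [show (2 : ℂ) * 1 * 1 = 2 by norm_num] at this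
  refine this.congr fun τ ↦ ?_
  simp only [thetaP]
  ring

/-- `((-iτ)^{1/2})² = -iτ`. [folklore] -/
theorem cpow_half_sq (τ : ℂ) : ((-I * τ) ^ (1 / 2 : ℂ)) ^ 2 = -I * τ := by
  have := Complex.cpow_nat_inv_pow (-I * τ) two_ne_zero
  rw [one_div]
  exact_mod_cast this

/-- `(-iτ)¹² = τ¹²`. [folklore] -/
theorem neg_I_mul_pow_twelve (τ : ℂ) : (-I * τ) ^ 12 = τ ^ 12 := by
  rw [mul_pow, show (-I : ℂ) ^ 12 = ((-I) ^ 2) ^ 6 by ring, neg_sq, I_sq]; ring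

/-- `(e^{πi/4})⁸ = 1`. [folklore] -/
theorem exp_pi_I_div_four_pow_eight : cexp (π * I / 4) ^ 8 = 1 := by
  rw [← Complex.exp_nat_mul, show ((8 : ℕ) : ℂ) * (π * I / 4) = 2 * π * I by push_cast; ring,
    Complex.exp_two_pi_mul_I]

/-! ### Weight-`12` level-one cusp forms from `D P⁷` and `P⁸` -/

section CuspForms

open UpperHalfPlane ModularForm SlashInvariantForm CongruenceSubgroup

open scoped MatrixGroups ModularForm

/-- A function on `ℂ` with `g(τ+1) = g(τ)`, `g(-1/τ) = τ¹² g(τ)`, holomorphic on `ℍ` and tending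
to `0` at `i∞` defines a cusp form of weight `12` and level one. [folklore] -/
def cuspFormOf (g : ℂ → ℂ) (hT : ∀ τ : ℂ, g (τ + 1) = g τ)
    (hS : ∀ τ : ℂ, 0 < im τ → g (-1 / τ) = τ ^ 12 * g τ)
    (hhol : ∀ τ : ℂ, 0 < im τ → DifferentiableAt ℂ g τ)
    (hzero : Tendsto g (comap im atTop) (𝓝 0)) : CuspForm 𝒮ℒ 12 where
  toFun := fun τ ↦ g τ
  slash_action_eq' A hA := by
    obtain ⟨A, rfl⟩ := hA
    have hS' : (fun τ : ℍ ↦ g τ) ∣[(12 : ℤ)] ModularGroup.S = fun τ : ℍ ↦ g τ := by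
      ext z
      rw [slash_S_apply]
      have hz : 0 < im (z : ℂ) := z.2
      have hz0 : (z : ℂ) ≠ 0 := ne_zero_of_im_pos hz
      change g (-(z : ℂ))⁻¹ * (z : ℂ) ^ (-(12 : ℤ)) = g z
      rw [inv_neg, ← one_div, ← neg_div, hS z hz, zpow_neg, zpow_ofNat]
      field_simp
    have hT' : (fun τ : ℍ ↦ g τ) ∣[(12 : ℤ)] ModularGroup.T = fun τ : ℍ ↦ g τ := by
      ext z
      rw [SL_slash_apply, modular_T_smul, UpperHalfPlane.coe_vadd]
      simp only [ModularGroup.T, denom]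
      push_cast
      rw [add_comm, hT]
      simp
    exact slash_action_generators_SL2Z hS' hT' A
  holo' := by
    rw [UpperHalfPlane.mdifferentiable_iff]
    have h1 : DifferentiableOn ℂ g {z : ℂ | 0 < z.im} := fun z hz ↦ (hhol z hz).differentiableWithinAt
    refine h1.congr fun z hz ↦ ?_
    simp [ofComplex_apply_of_im_pos hz]
  zero_at_cusps' hc := by
    rw [Subgroup.IsArithmetic.isCusp_iff_isCusp_SL2Z] at hc
    rw [OnePoint.isZeroAt_iff_forall_SL2Z hc]
    intro γ _
    have hS' : (fun τ : ℍ ↦ g τ) ∣[(12 : ℤ)] ModularGroup.S = fun τ : ℍ ↦ g τ := by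
      ext z
      rw [slash_S_apply]
      have hz : 0 < im (z : ℂ) := z.2
      have hz0 : (z : ℂ) ≠ 0 := ne_zero_of_im_pos hz
      change g (-(z : ℂ))⁻¹ * (z : ℂ) ^ (-(12 : ℤ)) = g z
      rw [inv_neg, ← one_div, ← neg_div, hS z hz, zpow_neg, zpow_ofNat]
      field_simp
    have hT' : (fun τ : ℍ ↦ g τ) ∣[(12 : ℤ)] ModularGroup.T = fun τ : ℍ ↦ g τ := by
      ext z
      rw [SL_slash_apply, modular_T_smul, UpperHalfPlane.coe_vadd]
      simp only [ModularGroup.T, denom]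
      push_cast
      rw [add_comm, hT]
      simp
    rw [slash_action_generators_SL2Z hS' hT']
    exact hzero.comp tendsto_coe_atImInfty

/-- The cusp form built from `g` is `g`. [folklore] -/
theorem cuspFormOf_apply (g : ℂ → ℂ) (hT : ∀ τ : ℂ, g (τ + 1) = g τ)
    (hS : ∀ τ : ℂ, 0 < im τ → g (-1 / τ) = τ ^ 12 * g τ)
    (hhol : ∀ τ : ℂ, 0 < im τ → DifferentiableAt ℂ g τ)
    (hzero : Tendsto g (comap im atTop) (𝓝 0)) (τ : ℍ) :
    cuspFormOf g hT hS hhol hzero τ = g τ := rfl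

/-- Every weight-`12` level-one cusp form is a multiple of `Δ`, pointwise. [folklore] -/
theorem exists_eq_mul_discriminant (F : CuspForm 𝒮ℒ 12) :
    ∃ c : ℂ, ∀ τ : ℍ, F τ = c * ModularForm.discriminant τ := by
  obtain ⟨c, hc⟩ := CuspForm.exists_smul_discriminant_of_weight_eq_twelve F
  refine ⟨c, fun τ ↦ ?_⟩
  have := congrArg (fun G : CuspForm 𝒮ℒ 12 ↦ G τ) hc
  simpa using this.symm

end CuspForms

/-! ### The two cusp forms `D P⁷`, `P⁸` and the conclusion -/

section Main

open scoped MatrixGroups ModularForm UpperHalfPlane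

/-- `F₁ = D P⁷` on `ℂ`. [folklore] -/
def F₁ (τ : ℂ) : ℂ := theta1' τ * thetaP τ ^ 7

/-- `F₂ = P⁸` on `ℂ`. [folklore] -/
def F₂ (τ : ℂ) : ℂ := thetaP τ ^ 8

/-- `F₁(τ + 1) = F₁(τ)` (`(e^{πi/4})⁸ = 1`). [folklore] -/
theorem F₁_add_one (τ : ℂ) : F₁ (τ + 1) = F₁ τ := by
  rw [F₁, F₁, theta1'_add_one, thetaP_add_one, mul_pow]
  linear_combination (theta1' τ * thetaP τ ^ 7) * exp_pi_I_div_four_pow_eight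

/-- `F₂(τ + 1) = F₂(τ)`. [folklore] -/
theorem F₂_add_one (τ : ℂ) : F₂ (τ + 1) = F₂ τ := by
  rw [F₂, F₂, thetaP_add_one, mul_pow, exp_pi_I_div_four_pow_eight, one_mul]

/-- `F₁(-1/τ) = τ¹² F₁(τ)`. [folklore] -/
theorem F₁_neg_one_div {τ : ℂ} (hτ : 0 < im τ) : F₁ (-1 / τ) = τ ^ 12 * F₁ τ := by
  rw [F₁, F₁, theta1'_neg_one_div hτ, thetaP_neg_one_div hτ, ← neg_I_mul_pow_twelve]
  have h2 := cpow_half_sq τ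
  set s := (-I * τ) ^ (1 / 2 : ℂ) with hs
  calc -I * τ * s * theta1' τ * (s ^ 3 * thetaP τ) ^ 7
      = -I * τ * (s ^ 2) ^ 11 * (theta1' τ * thetaP τ ^ 7) := by ring
    _ = (-I * τ) ^ 12 * (theta1' τ * thetaP τ ^ 7) := by rw [h2]; ring

/-- `F₂(-1/τ) = τ¹² F₂(τ)`. [folklore] -/
theorem F₂_neg_one_div {τ : ℂ} (hτ : 0 < im τ) : F₂ (-1 / τ) = τ ^ 12 * F₂ τ := by
  rw [F₂, F₂, thetaP_neg_one_div hτ, ← neg_I_mul_pow_twelve]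
  have h2 := cpow_half_sq τ
  set s := (-I * τ) ^ (1 / 2 : ℂ) with hs
  calc (s ^ 3 * thetaP τ) ^ 8 = (s ^ 2) ^ 12 * thetaP τ ^ 8 := by ring
    _ = (-I * τ) ^ 12 * thetaP τ ^ 8 := by rw [h2]

/-- `F₁` is holomorphic on `ℍ`. [folklore] -/
theorem differentiableAt_F₁ {τ : ℂ} (hτ : 0 < im τ) : DifferentiableAt ℂ F₁ τ := by
  unfold F₁
  exact (differentiableAt_theta1' hτ).mul ((differentiableAt_thetaP hτ).pow 7)

/-- `F₂` is holomorphic on `ℍ`. [folklore] -/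
theorem differentiableAt_F₂ {τ : ℂ} (hτ : 0 < im τ) : DifferentiableAt ℂ F₂ τ := by
  unfold F₂
  exact (differentiableAt_thetaP hτ).pow 8

/-- `e^{πiτ/4} → 0` at `i∞`. [folklore] -/
theorem tendsto_exp_quarter : Tendsto (fun τ : ℂ ↦ cexp (π * I * τ / 4)) (comap im atTop) (𝓝 0) := by
  rw [tendsto_zero_iff_norm_tendsto_zero]
  have h : ∀ τ : ℂ, ‖cexp (π * I * τ / 4)‖ = rexp (-(π / 4) * im τ) := by
    intro τ
    rw [Complex.norm_exp, show (π * I * τ / 4 : ℂ) = ((π / 4 : ℝ) : ℂ) * (τ * I) by push_cast; ring,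
      re_ofReal_mul, mul_I_re]
    congr 1
    ring
  simp_rw [h]
  exact tendsto_exp_neg_mul_im (by positivity)

/-- `D → 0` at `i∞`. [folklore] -/
theorem tendsto_theta1'_zero : Tendsto theta1' (comap im atTop) (𝓝 0) := by
  have := tendsto_exp_quarter.mul tendsto_theta1'
  rw [zero_mul] at this
  refine this.congr fun τ ↦ ?_
  rw [← mul_assoc, ← Complex.exp_add, add_neg_cancel, Complex.exp_zero, one_mul]

/-- `P → 0` at `i∞`. [folklore] -/
theorem tendsto_thetaP_zero : Tendsto thetaP (comap im atTop) (𝓝 0) := by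
  have := tendsto_exp_quarter.mul tendsto_thetaP
  rw [zero_mul] at this
  refine this.congr fun τ ↦ ?_
  rw [← mul_assoc, ← Complex.exp_add, add_neg_cancel, Complex.exp_zero, one_mul]

/-- `F₁ → 0` at `i∞`. [folklore] -/
theorem tendsto_F₁_zero : Tendsto F₁ (comap im atTop) (𝓝 0) := by
  have := tendsto_theta1'_zero.mul (tendsto_thetaP_zero.pow 7)
  rw [zero_mul] at this
  exact this

/-- `F₂ → 0` at `i∞`. [folklore] -/
theorem tendsto_F₂_zero : Tendsto F₂ (comap im atTop) (𝓝 0) := by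
  have := tendsto_thetaP_zero.pow 8
  rw [zero_pow (by norm_num)] at this
  exact this

/-- The cusp form `D P⁷ ∈ S₁₂(SL₂(ℤ))`. [folklore] -/
def cuspF₁ : CuspForm 𝒮ℒ 12 :=
  cuspFormOf F₁ F₁_add_one (fun _ hτ ↦ F₁_neg_one_div hτ) (fun _ hτ ↦ differentiableAt_F₁ hτ)
    tendsto_F₁_zero

/-- The cusp form `P⁸ ∈ S₁₂(SL₂(ℤ))`. [folklore] -/
def cuspF₂ : CuspForm 𝒮ℒ 12 :=
  cuspFormOf F₂ F₂_add_one (fun _ hτ ↦ F₂_neg_one_div hτ) (fun _ hτ ↦ differentiableAt_F₂ hτ)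
    tendsto_F₂_zero

/-- The filter `Im τ → ∞` on `ℂ` is nontrivial. [folklore] -/
instance neBot_comap_im : (comap im (atTop : Filter ℝ)).NeBot :=
  atTop_neBot.comap_of_surj Complex.im_surjective

/-- **`D = P` eventually at `i∞`.** [folklore] -/
theorem eventually_theta1'_eq_thetaP : ∀ᶠ τ in comap im atTop, theta1' τ = thetaP τ := by
  obtain ⟨c₁, hc₁⟩ := exists_eq_mul_discriminant cuspF₁
  obtain ⟨c₂, hc₂⟩ := exists_eq_mul_discriminant cuspF₂
  -- `P ≠ 0` eventually
  have hP : ∀ᶠ τ in comap im atTop, thetaP τ ≠ 0 := by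
    have h := tendsto_thetaP
    have : ∀ᶠ τ in comap im atTop, dist (cexp (-(π * I * τ / 4)) * thetaP τ) 2 < 1 :=
      h (Metric.ball_mem_nhds 2 one_pos)
    filter_upwards [this] with τ hτ
    intro h0
    rw [h0, mul_zero, dist_comm, dist_eq_norm] at hτ
    norm_num at hτ
  have him : ∀ᶠ τ in comap im atTop, 0 < im τ := by
    filter_upwards [preimage_mem_comap (Ioi_mem_atTop (0 : ℝ))] with τ hτ using hτ
  -- pointwise relation on `ℍ`
  have hrel : ∀ τ : ℂ, 0 < im τ → thetaP τ ≠ 0 → c₂ ≠ 0 ∧ theta1' τ = c₁ / c₂ * thetaP τ := by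
    intro τ hτ hPτ
    have e1 := hc₁ ⟨τ, hτ⟩
    have e2 := hc₂ ⟨τ, hτ⟩
    rw [cuspF₁, cuspFormOf_apply] at e1
    rw [cuspF₂, cuspFormOf_apply] at e2
    simp only [F₁, F₂] at e1 e2
    have hc₂0 : c₂ ≠ 0 := by
      intro h0
      rw [h0, zero_mul] at e2
      exact pow_ne_zero 8 hPτ e2
    refine ⟨hc₂0, ?_⟩
    have h7 : thetaP τ ^ 7 ≠ 0 := pow_ne_zero 7 hPτ
    have h : c₂ * (theta1' τ * thetaP τ ^ 7) = c₁ * thetaP τ ^ 8 := by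
      rw [e1]
      linear_combination (-c₁) * e2
    have h' : (theta1' τ * c₂ - c₁ * thetaP τ) * thetaP τ ^ 7 = 0 := by linear_combination h
    have key : theta1' τ * c₂ = c₁ * thetaP τ := by
      rcases mul_eq_zero.mp h' with h1 | h1
      · linear_combination h1
      · exact absurd h1 h7
    field_simp
    linear_combination key
  -- the constant is `1`
  have hc : ∀ᶠ τ in comap im atTop, theta1' τ = c₁ / c₂ * thetaP τ := by
    filter_upwards [hP, him] with τ hPτ hτ using (hrel τ hτ hPτ).2
  have hlim : Tendsto (fun τ : ℂ ↦ cexp (-(π * I * τ / 4)) * theta1' τ) (comap im atTop)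
      (𝓝 (c₁ / c₂ * 2)) := by
    have := tendsto_thetaP.const_mul (c₁ / c₂)
    refine this.congr' ?_
    filter_upwards [hc] with τ hτ
    rw [hτ]; ring
  have hc1 : c₁ / c₂ = 1 := by
    have h := tendsto_nhds_unique hlim tendsto_theta1'
    exact mul_right_cancel₀ two_ne_zero (h.trans (one_mul _).symm)
  filter_upwards [hc] with τ hτ
  rw [hτ, hc1, one_mul]

/-- **Jacobi's derivative formula** `θ₁'(0|τ) = π θ₂(τ) θ₃(τ) θ₄(τ)`, in the form
`D(τ) = ∑ (-1)ⁿ (2n+1) e^{πi(n+½)²τ} = θ₂(τ) θ₃(τ) θ₄(τ)` for all `τ` (both sides vanish off `ℍ`).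
Proof: `D P⁷` and `P⁸` are cusp forms of weight `12` for `SL₂(ℤ)`, hence proportional to `Δ`;
comparing the behaviour at `i∞` gives `D = P` near `i∞`, and the identity theorem concludes.
[cite: Lawden1989, §1.5 eq. (1.5.11)] -/
theorem theta1'_eq_thetaP (τ : ℂ) : theta1' τ = thetaP τ := by
  by_cases hτ : 0 < im τ
  · -- identity theorem on the upper half-plane
    obtain ⟨A, hA⟩ : ∃ A : ℝ, ∀ τ : ℂ, A ≤ im τ → theta1' τ = thetaP τ := by
      have h := eventually_theta1'_eq_thetaP
      rw [Filter.eventually_comap] at h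
      obtain ⟨A, hA⟩ := Filter.eventually_atTop.mp h
      exact ⟨A, fun τ hτ ↦ hA (im τ) hτ τ rfl⟩
    set U : Set ℂ := {z | 0 < z.im} with hU
    have hUo : IsOpen U := isOpen_lt continuous_const continuous_im
    have hD' : DifferentiableOn ℂ theta1' U :=
      fun z hz ↦ (differentiableAt_theta1' hz).differentiableWithinAt
    have hD : AnalyticOnNhd ℂ theta1' U := hD'.analyticOnNhd hUo
    have hPa' : DifferentiableOn ℂ thetaP U :=
      fun z hz ↦ (differentiableAt_thetaP hz).differentiableWithinAt
    have hPa : AnalyticOnNhd ℂ thetaP U := hPa'.analyticOnNhd hUo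
    have hUc : IsPreconnected U := (convex_halfSpace_im_gt 0).isPreconnected
    set A' : ℝ := max A 1 with hA'
    set z₀ : ℂ := ⟨0, A' + 1⟩ with hz₀
    have hz₀im : im z₀ = A' + 1 := rfl
    have hz₀U : z₀ ∈ U := by
      show 0 < im z₀
      rw [hz₀im]; positivity
    have hev : theta1' =ᶠ[𝓝 z₀] thetaP := by
      have hVo : IsOpen {z : ℂ | A' < z.im} := isOpen_lt continuous_const continuous_im
      have hzV : z₀ ∈ {z : ℂ | A' < z.im} := by show A' < im z₀; rw [hz₀im]; linarith
      filter_upwards [hVo.mem_nhds hzV] with z hz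
      exact hA z (le_trans (le_max_left A 1) (le_of_lt hz))
    exact hD.eqOn_of_preconnected_of_eventuallyEq hPa hUc hz₀U hev hτ
  · have hτ' : im τ ≤ 0 := not_lt.mp hτ
    rw [theta1', thetaP, theta3, jacobiTheta₂'_undef _ hτ', jacobiTheta₂_undef _ hτ']
    simp

/-- **Jacobi's derivative formula**, classical shape: `D = θ₂ θ₃ θ₄`. [cite: Lawden1989, §1.5 eq. (1.5.11)] -/
theorem jacobi_derivative_formula (τ : ℂ) : theta1' τ = theta2 τ * theta3 τ * theta4 τ :=
  theta1'_eq_thetaP τ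

end Main

end Literature.NumberTheory.EllipticCurves.JacobiThetaNull
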